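import Literature.NumberTheory.DiophantineGeometry.GeneralizedFermatTwoPowerCoefficientFreyTwoProofs
import Literature.NumberTheory.DiophantineGeometry.DenesEquationFreyCurveTwoProofs
import Literature.NumberTheory.DiophantineGeometry.TateAlgorithmIstarEvalProofs
import Literature.NumberTheory.DiophantineGeometry.TateAlgorithmIstarCharTwoProofs
import Literature.NumberTheory.DiophantineGeometry.TateAlgorithmExitMinimalityProofs
import HarnessLib

/-!
# The Frey curve at `2` in the "bad sign" `A ≡ 1 (mod 4)`: Tate's algorithm gives `I₀*`, `I₂*`
# and `f₂ = 4` for `ord₂ (B) ∈ {2, 3}` (proofs)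

Topic `Literature/NumberTheory/DiophantineGeometry`; a *proofs* file (theorems only: no
definition, no named fact, no `sorry`), sibling of
`GeneralizedFermatTwoPowerCoefficientFreyTwoProofs` (the "good sign" `A ≡ −1 (mod 4)`:
`4 ∥ B ⇒ I₁*, f₂ = 3`; `8 ∥ B ⇒ III*, f₂ = 3`), of `DenesEquationFreyCurveTwoProofs`
(`2 ∥ B ⇒ III, f₂ = 5`, no condition on `A mod 4`) and of
`FreyCurveConductorTwoTwistDichotomyProofs`, whose docstring records that *"the bad-sign values
`t = 4` themselves — types `I₀*`, `I₂*`, `I*_{2k−4}` — are not computed here"*.  This file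
computes the two bad-sign rows with `ord₂ (B) ∈ {2, 3}` for the Frey curve
`E_{A,B} : y² = x (x − A) (x + B)` (`Literature.NumberTheory.EllipticCurves.freyCurve A B`),
`A ≡ 1 (mod 4)`, by running the tree's literal Tate algorithm
(`DiophantineGeometry/TateAlgorithm*`, Silverman *ATAEC* IV.9.4) over `ℤ₂`:

* `kodairaSymbolAt_freyCurve_two_of_four_dvd_of_four_dvd_sub_one` — `A ≡ 1 (mod 4)`, `4 ∥ B`:
  type `I₀*`, `ord₂ Δ_min = 8`, `f₂ = 8 + 1 − 5 = 4` (the step-6 model `y ↦ y + x` has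
  coefficients `(2, B − A − 1, 0, −AB, 0)` with `2 ∥ B − A − 1`, `4 ∥ AB`; its cubic is
  `T (T² + p̄ T + q̄)` with `p̄ q̄ ≠ 0`, separable in characteristic `2`: Step 6 exits);
* `kodairaSymbolAt_freyCurve_two_of_eight_dvd_of_four_dvd_sub_one` — `A ≡ 1 (mod 4)`, `8 ∥ B`:
  type `I₂*`, `ord₂ Δ_min = 10`, `f₂ = 10 + 1 − 7 = 4` (same model, `8 ∥ AB`: the cubic is
  `T² (T + p̄)`, the double root already at `T = 0`; round `0` of the `Iₙ*` sub-procedure has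
  first quadratic `Y²` (double root, nothing to translate since `a₃ = a₆ = 0`) and second
  quadratic `p̄ X² + ū X`, `ū = (−AB/8)‾ ≠ 0`, separable, so `n = 2`);
* `conductorExponent_freyCurve_two_eq_four` — `A ≡ 1 (mod 4)`, `4 ∣ B`, `16 ∤ B ⇒ f₂ = 4`;
* (appendix) `kodairaSymbolAt_freyCurve_two_of_pow_dvd_of_four_dvd_sub_one` — `A ≡ 1 (mod 4)`, `2ᵏ ∥ B`,
  `k ≥ 3`: type `I*_{2k−4}`, `ord₂ Δ_min = 2k + 4`, `f₂ = 4` (minimality from the algorithm's exit,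
  `TateAlgorithmExitMinimalityProofs`; rounds `0 … k−4` silent, `istarIndexAux_add_of_dvd`), and
  `conductorExponent_freyCurve_two_eq_four_of_four_dvd` — `A ≡ 1 (mod 4)`, `4 ∣ B ⇒ f₂ = 4` with no bound on
  `ord₂ B`: the bad sign is COMPLETE;
* `conductorExponent_freyCurve_two_eq_three_or_four` (`A` odd, `4 ∣ B`, `16 ∤ B`) and
  `conductorExponent_freyCurve_two_ne_two_of_not_sixteen_dvd` (`A` odd, `2 ∣ B`, `16 ∤ B ⇒
  f₂ ∈ {3, 4, 5}`, in particular `f₂ ≠ 2`) — the complete table of `E_{A,B}` at `2` for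
  `ord₂ (B) ≤ 3`, both signs.

In print: Diamond–Kramer 1995, Lemma 2 (p. 300) tabulate `(type, f₂, ord₂ Δ_min)` at `2` for the
model `y² = x (x − A) (x + B)` over `ℚ₂` with `A ≡ −1 (mod 4)`, `B` even, by exactly these
translations (*"Put `y + x` for `y` in (2) to get (3) … use the model (3) with
`ord₂ (Δ) = 10`"*), and reduce the general case to it in Lemma 1 (p. 300: *"Finally, if
`A ≡ 1 mod 4`, we twist again by `ℚ(i)`"*) — the bad-sign curve `E_{A,B}` is the quadratic
twist by `−1` of the good-sign curve `E_{B,A}` (`quadraticTwist_freyCurve_neg_one`).  The values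
`I₀*, I₂*, f₂ = 4` are those of Tate's algorithm (Silverman *ATAEC* IV.9.4, Table 4.1) and of
Ogg's formula (the tree's *definition* of `conductorExponent`, *ATAEC* IV.11.1); they agree
with PARI's `elllocalred` (census `j017118` of `FreyCurveConductorTwoTwistDichotomyProofs`:
`t = 4` exactly in the bad-sign classes; cell bsd-f2-manin kit jobs `j303605`/`j303622`:
`w ≡ 1 (mod 4) ⇒ I₀*, f = 4`).  Motivation (cell bsd-f2-manin, C2 `ManinOddAtFour`, imc §20.9
E-imc-75-loc): with the good-sign rows, every presentation `y² = x (x − A) (x + B)`, `A` odd,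
`2 ∣ B`, `16 ∤ B`, has `f₂ ∈ {3, 4, 5}`, never the tame value `f₂ = 2`.

Tools: `kodairaSymbolOfMinimal_eq_Istar_zero_of_step6` (`TateAlgorithmEvalProofs`),
`kodairaSymbolOfMinimal_eq_Istar_of_models`, `istarIndexAux_succ_of_testB`,
`kodairaSymbolAt_eq_kodairaSymbolOfMinimal_of_isMinimal`, `ordMinimalDiscriminant_eq_of_isMinimal`
(`TateAlgorithmIstarEvalProofs`), `kodairaSymbolOfMinimal_smul` (`TateAlgorithmInvarianceProofs`),
the characteristic-`2` tests `testA/testB_iff_of_two_eq_zero` (`TateAlgorithmIstarCharTwoProofs`),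
and the `2`-adic bookkeeping, the step-6 model `freyModel₆_eq` and the minimality lemma
`isMinimalAt_freyCurve_two` of `GeneralizedFermatTwoPowerCoefficientFreyTwoProofs`.

## References

* [DiamondKramer1995] F. Diamond, K. Kramer, *Modularity of a family of elliptic curves*, Math.
  Res. Lett. 2 (1995), 299–304: Lemma 1 and Lemma 2 with its proof, p. 300.
* [SilvermanATAEC1994] J. H. Silverman, *Advanced Topics in the Arithmetic of Elliptic Curves*,
  GTM 151, IV.9.4 (Tate's algorithm, Steps 1–7), Table 4.1, IV.11.1 (Ogg's formula).
* [Ribet1997] K. A. Ribet, *On the equation `a^p + 2^α b^p + c^p = 0`*, Acta Arith. 79 (1997),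
  §2, pp. 10–11 (the good-sign table as quoted in the siblings).
-/

noncomputable section

open IsDedekindDomain WeierstrassCurve Rat.HeightOneSpectrum IsLocalRing Polynomial
open IsDiscreteValuationRing hiding maximalIdeal
open Literature.NumberTheory.DiophantineGeometry.TateAlgorithm Literature.NumberTheory.EllipticCurves

namespace Literature.NumberTheory.DiophantineGeometry

section Local

variable {A B : ℤ} (v : HeightOneSpectrum ℤ)

/-- `4 ∣ A − 1` makes `A` odd. [folklore] -/
private theorem not_two_dvd_of_four_dvd_sub_one (hA : 4 ∣ A - 1) : ¬ (2 : ℤ) ∣ A := by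
  obtain ⟨k, hk⟩ := hA
  omega

/-! ### Case `A ≡ 1 (mod 4)`, `4 ∥ B`: type `I₀*`, `ord₂ Δ_min = 8`, `f₂ = 4` -/

/-- **The Frey curve `y² = x (x − A) (x + B)` with `A ≡ 1 (mod 4)`, `4 ∥ B`, at `2`: Kodaira
type `I₀*`, `ord₂ (Δ_min) = 8`, conductor exponent `f₂ = 8 + 1 − 5 = 4`** — the "bad sign"
companion of `kodairaSymbolAt_freyCurve_two_of_four_dvd` (`A ≡ −1 (mod 4)`: `I₁*`, `f₂ = 3`),
i.e. the quadratic twist by `−1` of Diamond–Kramer's row `ord₂ (B) = 2` (Lemma 1, p. 300: "if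
`A ≡ 1 mod 4`, we twist again by `ℚ(i)`").  Tate's algorithm (Silverman *ATAEC* IV.9.4): the
integral equation `y² = x³ + (B − A) x² − AB x` is minimal (`ord₂ Δ = 8`); `y ↦ y + x`
(Diamond–Kramer's model (3)) gives the step-6 normalised model `(2, B − A − 1, 0, −AB, 0)`
(`π ∣ a₁, a₂`, `π² ∣ a₃, a₄`, `π³ ∣ a₆`) with `π ∥ a₂` (`B − A − 1 ≡ 2 (mod 4)`) and
`π² ∥ a₄`; its cubic `T³ + p̄ T² + q̄ T` has discriminant `p̄² q̄² ≠ 0` in characteristic `2`,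
three distinct roots, so Step 6 returns `I₀*` (`kodairaSymbolOfMinimal_eq_Istar_zero_of_step6`).
[cite: DiamondKramer1995, Lemma 1 and Lemma 2, p. 300]
[cite: SilvermanATAEC1994, IV.9.4 Steps 1–6 and Table 4.1] -/
theorem kodairaSymbolAt_freyCurve_two_of_four_dvd_of_four_dvd_sub_one (hv : natGenerator v = 2)
    (h0 : A * B * (A + B) ≠ 0) (hA : 4 ∣ A - 1) {b : ℤ} (hB : B = 4 * b) (hb : ¬ (2 : ℤ) ∣ b) :
    (freyCurve A B).kodairaSymbolAt v = .Istar 0 ∧ (freyCurve A B).ordMinimalDiscriminant v = 8 ∧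
      (freyCurve A B).conductorExponent v = 4 := by
  haveI := isElliptic_freyCurve h0
  haveI hI := isIntegral_baseChange_freyCurve (A := A) (B := B) v
  have hA2 : ¬ (2 : ℤ) ∣ A := not_two_dvd_of_four_dvd_sub_one hA
  obtain ⟨k, hk⟩ := hA
  obtain ⟨c, hc⟩ : ∃ c : ℤ, b = 2 * c + 1 := ⟨b / 2, by omega⟩
  have hAk : A = 4 * k + 1 := by linear_combination hk
  have hBc : B = 8 * c + 4 := by rw [hB, hc]; ring
  have hAB : ¬ (2 : ℤ) ∣ A + B := by
    rw [hAk, hBc]; intro h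
    have : (2 : ℤ) ∣ (4 * k + 1 + (8 * c + 4)) - 2 * (2 * k + 4 * c + 2) :=
      dvd_sub h (dvd_mul_right 2 _)
    have h1 : (4 * k + 1 + (8 * c + 4)) - 2 * (2 * k + 4 * c + 2) = (1 : ℤ) := by ring
    rw [h1] at this
    exact absurd this (by norm_num)
  have hB' : B = 2 ^ 2 * b := by rw [hB]; ring
  haveI hmin : ((freyCurve A B).baseChange (v.adicCompletion ℚ)).IsMinimal
      (v.adicCompletionIntegers ℚ) :=
    isMinimalAt_freyCurve_two v hv (by norm_num) hB' hb hA2 hAB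
  have hΔ : ((freyCurve A B).baseChange (v.adicCompletion ℚ)).Δ ≠ 0 := by
    haveI : ((freyCurve A B).baseChange (v.adicCompletion ℚ)).IsElliptic := by
      rw [WeierstrassCurve.baseChange]; infer_instance
    exact ((freyCurve A B).baseChange (v.adicCompletion ℚ)).isUnit_Δ.ne_zero
  have hrel : (freyCurve A B).baseChange (v.adicCompletion ℚ) =
      (1 : VariableChange (v.adicCompletion ℚ)) • (freyCurve A B).baseChange (v.adicCompletion ℚ) :=
    (one_smul _ _).symm
  have hIM := integralModel_baseChange_freyCurve (A := A) (B := B) v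
  have h2 := residue_two_eq_zero_int v hv
  set φ := algebraMap ℤ (v.adicCompletionIntegers ℚ) with hφ
  set W₀ := (freyIntModel A B).map φ with hW₀
  set W₆ := (⟨2, B - A - 1, 0, -(A * B), 0⟩ : WeierstrassCurve ℤ).map φ with hW₆def
  set C₆ : VariableChange (v.adicCompletionIntegers ℚ) := (⟨1, 0, 1, 0⟩ : VariableChange ℤ).map φ
    with hC₆
  have hW₆ : W₆ = C₆ • W₀ := by
    rw [hW₀, hC₆, map_variableChange, freyModel₆_eq]
  -- `ord₂ Δ(W₀) = 8`
  have hordΔ : (addVal (v.adicCompletionIntegers ℚ) W₀.Δ).toNat = 8 :=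
    addVal_Δ_freyIntModel_map_toNat v hv hB' hb hA2 hAB
  -- Step 6 on `W₆`: three distinct roots
  have hp : redCoeff W₆.a₂ 1 ≠ 0 := by
    have hdvd : uniformizer (v.adicCompletionIntegers ℚ) ^ 1 ∣ W₆.a₂ := by
      simp only [hW₆def, map_a₂, hφ, eq_intCast]
      exact uniformizer_pow_dvd_intCast v hv (k := 1) ⟨4 * c - 2 * k + 1, by rw [hAk, hBc]; ring⟩
    rw [Ne, redCoeff_eq_zero_iff hdvd]
    simp only [hW₆def, map_a₂, hφ, eq_intCast]
    refine not_uniformizer_pow_succ_dvd_intCast v hv (k := 1) (m := 4 * c - 2 * k + 1)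
      (by rw [hAk, hBc]; ring) ?_
    intro h
    have : (2 : ℤ) ∣ (4 * c - 2 * k + 1) - 2 * (2 * c - k) := dvd_sub h (dvd_mul_right 2 _)
    have h1 : (4 * c - 2 * k + 1) - 2 * (2 * c - k) = (1 : ℤ) := by ring
    rw [h1] at this
    exact absurd this (by norm_num)
  have hq : redCoeff W₆.a₄ 2 ≠ 0 := by
    have hdvd : uniformizer (v.adicCompletionIntegers ℚ) ^ 2 ∣ W₆.a₄ := by
      simp only [hW₆def, map_a₄, hφ, eq_intCast]
      exact uniformizer_pow_dvd_intCast v hv (k := 2) ⟨-(A * b), by rw [hB]; ring⟩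
    rw [Ne, redCoeff_eq_zero_iff hdvd]
    simp only [hW₆def, map_a₄, hφ, eq_intCast]
    refine not_uniformizer_pow_succ_dvd_intCast v hv (k := 2) (m := -(A * b)) (by rw [hB]; ring) ?_
    rw [dvd_neg]
    intro h
    rcases Int.prime_two.dvd_or_dvd h with h | h
    · exact hA2 h
    · exact hb h
  have hr : redCoeff W₆.a₆ 3 = 0 := by
    refine redCoeff_eq_zero_of_dvd ?_
    simp only [hW₆def, map_a₆, hφ, eq_intCast, Int.cast_zero]; exact dvd_zero _
  have hK6 : W₆.kodairaSymbolOfMinimal = .Istar 0 := by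
    refine kodairaSymbolOfMinimal_eq_Istar_zero_of_step6 ?_ ?_ ?_ ?_ ?_ ?_
    · simp only [hW₆def, map_a₁, hφ, eq_intCast]
      simpa using uniformizer_pow_dvd_intCast v hv (k := 1) (n := 2) (by norm_num)
    · simp only [hW₆def, map_a₂, hφ, eq_intCast]
      simpa using uniformizer_pow_dvd_intCast v hv (k := 1) (n := B - A - 1)
        ⟨4 * c - 2 * k + 1, by rw [hAk, hBc]; ring⟩
    · simp only [hW₆def, map_a₃, hφ, eq_intCast, Int.cast_zero]; exact dvd_zero _
    · simp only [hW₆def, map_a₄, hφ, eq_intCast]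
      exact uniformizer_pow_dvd_intCast v hv (k := 2) ⟨-(A * b), by rw [hB]; ring⟩
    · simp only [hW₆def, map_a₆, hφ, eq_intCast, Int.cast_zero]; exact dvd_zero _
    · set p := redCoeff W₆.a₂ 1 with hpdef
      set q := redCoeff W₆.a₄ 2 with hqdef
      show distinctRootCount (X ^ 3 + C (redCoeff W₆.a₂ 1) * X ^ 2 + C (redCoeff W₆.a₄ 2) * X +
        C (redCoeff W₆.a₆ 3)) = 3
      rw [hr, ← hpdef, ← hqdef]
      have h4 : (4 : ResidueField (v.adicCompletionIntegers ℚ)) = 0 := by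
        rw [show (4 : ResidueField (v.adicCompletionIntegers ℚ)) = 2 * 2 by norm_num, h2, mul_zero]
      refine (distinctRootCount_cubic_eq_three_iff p q 0).mpr ?_
      have hid : p ^ 2 * q ^ 2 - 4 * q ^ 3 - 4 * p ^ 3 * 0 - 27 * 0 ^ 2 + 18 * p * q * 0 =
          (p * q) ^ 2 := by
        rw [h4]; ring
      rw [hid]
      exact pow_ne_zero 2 (mul_ne_zero hp hq)
  have hK : (freyCurve A B).kodairaSymbolAt v = .Istar 0 := by
    rw [kodairaSymbolAt_eq_kodairaSymbolOfMinimal_of_isMinimal v (freyCurve A B) _ 1 hrel hΔ, hIM,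
      ← kodairaSymbolOfMinimal_smul W₀ C₆, ← hW₆, hK6]
  have hord : (freyCurve A B).ordMinimalDiscriminant v = 8 := by
    rw [ordMinimalDiscriminant_eq_of_isMinimal v (freyCurve A B) _ 1 hrel hΔ, hIM, hordΔ]
  refine ⟨hK, hord, ?_⟩
  show (freyCurve A B).ordMinimalDiscriminant v + 1 - (freyCurve A B).numComponentsAt v = 4
  rw [numComponentsAt, hK, hord]
  rfl

/-! ### Case `A ≡ 1 (mod 4)`, `8 ∥ B`: type `I₂*`, `ord₂ Δ_min = 10`, `f₂ = 4` -/

/-- **The Frey curve `y² = x (x − A) (x + B)` with `A ≡ 1 (mod 4)`, `8 ∥ B`, at `2`: Kodaira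
type `I₂*`, `ord₂ (Δ_min) = 10`, conductor exponent `f₂ = 10 + 1 − 7 = 4`** — the "bad sign"
companion of `kodairaSymbolAt_freyCurve_two_of_eight_dvd` (`A ≡ −1 (mod 4)`: `III*`, `f₂ = 3`),
the quadratic twist by `−1` of Diamond–Kramer's row `ord₂ (B) = 3` (Lemma 1 and Lemma 2,
p. 300).  Tate's algorithm (Silverman *ATAEC* IV.9.4, Steps 1–7): the integral equation is
minimal (`ord₂ Δ = 10`) and step-2 normalised (`π ∣ a₃, a₄, a₆`, `π ∣ b₂`, `π² ∣ a₆`,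
`π³ ∣ b₈, b₆`); `y ↦ y + x` gives the step-6 model `W₆ = (2, B − A − 1, 0, −AB, 0)` with
`π ∥ a₂`, `π³ ∥ a₄`, `a₃ = a₆ = 0`, whose cubic `T² (T + p̄)`, `p̄ ≠ 0`, has exactly two roots,
the double one at `T = 0`, so `W₆` itself is normalised for round `0` of the `Iₙ*`
sub-procedure; there the first quadratic `Y² + (a₃/π²)‾ Y − (a₆/π⁴)‾ = Y²` has a double root, no
translation is needed (`π³ ∣ a₃`, `π⁵ ∣ a₆` already), and the second quadratic
`p̄ X² + (a₄/π³)‾ X + (a₆/π⁵)‾ = p̄ X² + ū X`, `ū ≠ 0` (`AB/8` odd), is separable: `n = 2`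
(`kodairaSymbolOfMinimal_eq_Istar_of_models`, `istarIndexAux_succ_of_testB`).
[cite: DiamondKramer1995, Lemma 1 and Lemma 2, p. 300]
[cite: SilvermanATAEC1994, IV.9.4 Steps 1–7 and Table 4.1] -/
theorem kodairaSymbolAt_freyCurve_two_of_eight_dvd_of_four_dvd_sub_one (hv : natGenerator v = 2)
    (h0 : A * B * (A + B) ≠ 0) (hA : 4 ∣ A - 1) {b : ℤ} (hB : B = 8 * b) (hb : ¬ (2 : ℤ) ∣ b) :
    (freyCurve A B).kodairaSymbolAt v = .Istar 2 ∧ (freyCurve A B).ordMinimalDiscriminant v = 10 ∧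
      (freyCurve A B).conductorExponent v = 4 := by
  haveI := isElliptic_freyCurve h0
  haveI hI := isIntegral_baseChange_freyCurve (A := A) (B := B) v
  have hA2 : ¬ (2 : ℤ) ∣ A := not_two_dvd_of_four_dvd_sub_one hA
  obtain ⟨k, hk⟩ := hA
  have hAk : A = 4 * k + 1 := by linear_combination hk
  have hAB : ¬ (2 : ℤ) ∣ A + B := by
    rw [hB]; intro h; apply hA2
    have : A = (A + 8 * b) - 2 * (4 * b) := by ring
    rw [this]; exact dvd_sub h (dvd_mul_right 2 _)
  have hB' : B = 2 ^ 3 * b := by rw [hB]; ring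
  have hAb : ¬ (2 : ℤ) ∣ A * b := by
    intro h
    rcases Int.prime_two.dvd_or_dvd h with h | h
    · exact hA2 h
    · exact hb h
  have hodd₂ : ¬ (2 : ℤ) ∣ 4 * b - 2 * k - 1 := by
    intro h
    have : (2 : ℤ) ∣ 2 * (2 * b - k) - (4 * b - 2 * k - 1) := dvd_sub (dvd_mul_right 2 _) h
    have h1 : 2 * (2 * b - k) - (4 * b - 2 * k - 1) = (1 : ℤ) := by ring
    rw [h1] at this
    exact absurd this (by norm_num)
  haveI hmin : ((freyCurve A B).baseChange (v.adicCompletion ℚ)).IsMinimal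
      (v.adicCompletionIntegers ℚ) :=
    isMinimalAt_freyCurve_two v hv (by norm_num) hB' hb hA2 hAB
  have hΔ : ((freyCurve A B).baseChange (v.adicCompletion ℚ)).Δ ≠ 0 := by
    haveI : ((freyCurve A B).baseChange (v.adicCompletion ℚ)).IsElliptic := by
      rw [WeierstrassCurve.baseChange]; infer_instance
    exact ((freyCurve A B).baseChange (v.adicCompletion ℚ)).isUnit_Δ.ne_zero
  have hrel : (freyCurve A B).baseChange (v.adicCompletion ℚ) =
      (1 : VariableChange (v.adicCompletion ℚ)) • (freyCurve A B).baseChange (v.adicCompletion ℚ) :=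
    (one_smul _ _).symm
  have hIM := integralModel_baseChange_freyCurve (A := A) (B := B) v
  have h2 := residue_two_eq_zero_int v hv
  set φ := algebraMap ℤ (v.adicCompletionIntegers ℚ) with hφ
  set W₀ := (freyIntModel A B).map φ with hW₀
  set W₆ := (⟨2, B - A - 1, 0, -(A * B), 0⟩ : WeierstrassCurve ℤ).map φ with hW₆def
  set C₆ : VariableChange (v.adicCompletionIntegers ℚ) := (⟨1, 0, 1, 0⟩ : VariableChange ℤ).map φ
    with hC₆
  have hW₆ : W₆ = C₆ • W₀ := by
    rw [hW₀, hC₆, map_variableChange, freyModel₆_eq]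
  -- `ord₂ Δ(W₀) = 10`
  have hordΔ : (addVal (v.adicCompletionIntegers ℚ) W₀.Δ).toNat = 10 :=
    addVal_Δ_freyIntModel_map_toNat v hv hB' hb hA2 hAB
  -- divisibilities of the step-6 model `W₆ = (2, B − A − 1, 0, −AB, 0)`
  have q1 : uniformizer (v.adicCompletionIntegers ℚ) ∣ W₆.a₁ := by
    simp only [hW₆def, map_a₁, hφ, eq_intCast]
    simpa using uniformizer_pow_dvd_intCast v hv (k := 1) (n := 2) (by norm_num)
  have q2 : uniformizer (v.adicCompletionIntegers ℚ) ∣ W₆.a₂ := by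
    simp only [hW₆def, map_a₂, hφ, eq_intCast]
    simpa using uniformizer_pow_dvd_intCast v hv (k := 1) (n := B - A - 1)
      ⟨4 * b - 2 * k - 1, by rw [hAk, hB]; ring⟩
  have q2n : ¬ uniformizer (v.adicCompletionIntegers ℚ) ^ 2 ∣ W₆.a₂ := by
    simp only [hW₆def, map_a₂, hφ, eq_intCast]
    exact not_uniformizer_pow_succ_dvd_intCast v hv (k := 1) (m := 4 * b - 2 * k - 1)
      (by rw [hAk, hB]; ring) hodd₂
  have q3 : uniformizer (v.adicCompletionIntegers ℚ) ^ 3 ∣ W₆.a₃ := by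
    simp only [hW₆def, map_a₃, hφ, eq_intCast, Int.cast_zero]; exact dvd_zero _
  have q4 : uniformizer (v.adicCompletionIntegers ℚ) ^ 3 ∣ W₆.a₄ := by
    simp only [hW₆def, map_a₄, hφ, eq_intCast]
    exact uniformizer_pow_dvd_intCast v hv (k := 3) ⟨-(A * b), by rw [hB]; ring⟩
  have q4n : ¬ uniformizer (v.adicCompletionIntegers ℚ) ^ 4 ∣ W₆.a₄ := by
    simp only [hW₆def, map_a₄, hφ, eq_intCast]
    refine not_uniformizer_pow_succ_dvd_intCast v hv (k := 3) (m := -(A * b)) (by rw [hB]; ring) ?_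
    rwa [dvd_neg]
  have q6 : uniformizer (v.adicCompletionIntegers ℚ) ^ 5 ∣ W₆.a₆ := by
    simp only [hW₆def, map_a₆, hφ, eq_intCast, Int.cast_zero]; exact dvd_zero _
  have q2' : uniformizer (v.adicCompletionIntegers ℚ) ^ 1 ∣ W₆.a₂ := by simpa using q2
  have hp : redCoeff W₆.a₂ 1 ≠ 0 := by
    rw [Ne, redCoeff_eq_zero_iff q2']
    exact q2n
  have hq0 : redCoeff W₆.a₄ 2 = 0 := redCoeff_eq_zero_of_dvd q4
  have hu : redCoeff W₆.a₄ 3 ≠ 0 := by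
    rw [Ne, redCoeff_eq_zero_iff q4]
    exact q4n
  have hr : redCoeff W₆.a₆ 3 = 0 :=
    redCoeff_eq_zero_of_dvd ((pow_dvd_pow _ (by norm_num)).trans q6)
  -- the evaluation: type `Iₙ*` with `n` computed by the sub-procedure on `W₆` itself
  have hK0 : W₀.kodairaSymbolOfMinimal =
      .Istar (istarIndexAux (addVal (v.adicCompletionIntegers ℚ) W₀.Δ).toNat 0 W₆) := by
    refine kodairaSymbolOfMinimal_eq_Istar_of_models (W₂ := W₀) (C₂ := 1) ?_ (one_smul _ _).symm
      ?_ ?_ ?_ ?_ ?_ ?_ ?_ hW₆ q1 q2 ((pow_dvd_pow _ (by norm_num)).trans q3)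
      ((pow_dvd_pow _ (by norm_num)).trans q4) ((pow_dvd_pow _ (by norm_num)).trans q6) ?_
      (one_smul _ _).symm q1 q2 q2n ((pow_dvd_pow _ (by norm_num)).trans q3) q4
      ((pow_dvd_pow _ (by norm_num)).trans q6)
    · -- `ϖ ∣ Δ = 16 (AB(A+B))²`
      rw [hW₀, map_Δ, freyIntModel_Δ, hφ, eq_intCast]
      simpa only [pow_one] using uniformizer_pow_dvd_intCast v hv (k := 1)
        (n := 16 * (A * B * (A + B)) ^ 2) ⟨8 * (A * B * (A + B)) ^ 2, by ring⟩
    · simp only [hW₀, freyIntModel, map_a₃, hφ, eq_intCast, Int.cast_zero]; exact dvd_zero _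
    · simp only [hW₀, freyIntModel, map_a₄, hφ, eq_intCast]
      simpa using uniformizer_pow_dvd_intCast v hv (k := 1) (n := -(A * B)) ⟨-(4 * A * b), by rw [hB]; ring⟩
    · simp only [hW₀, freyIntModel, map_a₆, hφ, eq_intCast, Int.cast_zero]; exact dvd_zero _
    · rw [hW₀, map_b₂, (freyIntModel_b A B).1, hφ, eq_intCast]
      simpa using uniformizer_pow_dvd_intCast v hv (k := 1) (n := 4 * (B - A)) ⟨2 * (B - A), by ring⟩
    · simp only [hW₀, freyIntModel, map_a₆, hφ, eq_intCast, Int.cast_zero]; exact dvd_zero _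
    · rw [hW₀, map_b₈, (freyIntModel_b A B).2.2, hφ, eq_intCast]
      exact uniformizer_pow_dvd_intCast v hv (k := 3) ⟨-(8 * A ^ 2 * b ^ 2), by rw [hB]; ring⟩
    · rw [hW₀, map_b₆, (freyIntModel_b A B).2.1, hφ, eq_intCast, Int.cast_zero]; exact dvd_zero _
    · -- the step-6 cubic `T² (T + p̄)`, `p̄ ≠ 0`: exactly two distinct roots
      set p := redCoeff W₆.a₂ 1 with hpdef
      show distinctRootCount (X ^ 3 + C (redCoeff W₆.a₂ 1) * X ^ 2 + C (redCoeff W₆.a₄ 2) * X +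
        C (redCoeff W₆.a₆ 3)) = 2
      rw [hq0, hr, ← hpdef]
      refine (distinctRootCount_cubic_eq_two_iff p 0 0 (by ring)).mpr ?_
      rw [mul_zero, sub_zero]
      exact pow_ne_zero 2 hp
  -- round `0` of the sub-procedure on `W₆`: first quadratic `Y²` (double root), second
  -- quadratic `p̄ X² + ū X` separable, so `n = 2`
  have hA7 : distinctRootCount (X ^ 2 + C (redCoeff W₆.a₃ (0 + 2)) * X -
      C (redCoeff W₆.a₆ (2 * 0 + 4))) ≠ 2 := by
    have h3 : redCoeff W₆.a₃ (0 + 2) = 0 := redCoeff_eq_zero_of_dvd (by simpa using q3)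
    intro h
    exact ((testA_iff_of_two_eq_zero h2 _ _).mp h) h3
  have hB7 : distinctRootCount (C (redCoeff W₆.a₂ 1) * X ^ 2 + C (redCoeff W₆.a₄ (0 + 3)) * X
      + C (redCoeff W₆.a₆ (2 * 0 + 5))) = 2 := by
    rw [show (0 + 3 : ℕ) = 3 from rfl, show (2 * 0 + 5 : ℕ) = 5 from rfl]
    exact (testB_iff_of_two_eq_zero h2 hp _ _).mpr hu
  have hn : istarIndexAux (addVal (v.adicCompletionIntegers ℚ) W₀.Δ).toNat 0 W₆ = 2 := by
    rw [hordΔ, show (10 : ℕ) = 9 + 1 from rfl]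
    exact istarIndexAux_succ_of_testB (fuel := 9) (m := 0) (W := W₆) (W₁ := W₆) (C₁ := 1)
      q1 q2 q2n ((pow_dvd_pow _ (by norm_num)).trans q3) (by simpa using q4)
      ((pow_dvd_pow _ (by norm_num)).trans q6) hA7 (one_smul _ _).symm q1 q2 q2n
      (by simpa using q3) (by simpa using q4) (by simpa using q6) hB7
  rw [hn] at hK0
  have hK : (freyCurve A B).kodairaSymbolAt v = .Istar 2 := by
    rw [kodairaSymbolAt_eq_kodairaSymbolOfMinimal_of_isMinimal v (freyCurve A B) _ 1 hrel hΔ, hIM,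
      hK0]
  have hord : (freyCurve A B).ordMinimalDiscriminant v = 10 := by
    rw [ordMinimalDiscriminant_eq_of_isMinimal v (freyCurve A B) _ 1 hrel hΔ, hIM, hordΔ]
  refine ⟨hK, hord, ?_⟩
  show (freyCurve A B).ordMinimalDiscriminant v + 1 - (freyCurve A B).numComponentsAt v = 4
  rw [numComponentsAt, hK, hord]
  rfl

/-! ### Summary: `f₂ = 4` in the bad sign; `f₂ ∈ {3, 4, 5}` for every `ord₂ (B) ≤ 3` -/

/-- **`f₂ = 4` for `A ≡ 1 (mod 4)`, `4 ∣ B`, `16 ∤ B`** (`AB(A+B) ≠ 0`): the two bad-sign rows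
`4 ∥ B` (`I₀*`, `8 + 1 − 5`) and `8 ∥ B` (`I₂*`, `10 + 1 − 7`) of the Frey curve
`y² = x (x − A) (x + B)` at `2` — the twist by `ℚ(i)` of Diamond–Kramer's rows `t = 3`
(Lemma 1, Lemma 2, p. 300); the value `t = 4` is the one recorded (from PARI) in the docstring of
`FreyCurveConductorTwoTwistDichotomyProofs`. [cite: DiamondKramer1995, Lemma 1 and Lemma 2, p. 300]
[cite: SilvermanATAEC1994, IV.9.4 and Table 4.1, IV.11.1] -/
theorem conductorExponent_freyCurve_two_eq_four (hv : natGenerator v = 2)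
    (h0 : A * B * (A + B) ≠ 0) (hA : A ≡ 1 [ZMOD 4]) (h4 : (4 : ℤ) ∣ B) (h16 : ¬ (16 : ℤ) ∣ B) :
    (freyCurve A B).conductorExponent v = 4 := by
  have hA' : 4 ∣ A - 1 := (Int.ModEq.dvd hA.symm)
  obtain ⟨b₀, hb₀⟩ := h4
  by_cases h2 : (2 : ℤ) ∣ b₀
  · obtain ⟨b, hb⟩ := h2
    have hbodd : ¬ (2 : ℤ) ∣ b := fun ⟨e, he⟩ ↦ h16 ⟨e, by rw [hb₀, hb, he]; ring⟩
    exact (kodairaSymbolAt_freyCurve_two_of_eight_dvd_of_four_dvd_sub_one v hv h0 hA' (b := b)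
      (by rw [hb₀, hb]; ring) hbodd).2.2
  · exact (kodairaSymbolAt_freyCurve_two_of_four_dvd_of_four_dvd_sub_one v hv h0 hA' hb₀ h2).2.2

/-- **`f₂ ∈ {3, 4}` for `A` odd, `4 ∣ B`, `16 ∤ B`**: `A ≡ −1 (mod 4)` gives `3`
(`conductorExponent_freyCurve_two_eq_three`, Diamond–Kramer's rows `ord₂ (B) ∈ {2, 3}`), `A ≡ 1
(mod 4)` gives `4` (`conductorExponent_freyCurve_two_eq_four`).
[cite: DiamondKramer1995, Lemma 1 and Lemma 2, p. 300] [cite: SilvermanATAEC1994, IV.9.4, IV.11.1] -/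
theorem conductorExponent_freyCurve_two_eq_three_or_four (hv : natGenerator v = 2)
    (h0 : A * B * (A + B) ≠ 0) (hA : ¬ (2 : ℤ) ∣ A) (h4 : (4 : ℤ) ∣ B) (h16 : ¬ (16 : ℤ) ∣ B) :
    (freyCurve A B).conductorExponent v = 3 ∨ (freyCurve A B).conductorExponent v = 4 := by
  have h4' : A % 4 = 1 ∨ A % 4 = 3 := by omega
  rcases h4' with h1 | h3
  · have hp : A ≡ 1 [ZMOD 4] := by show A % 4 = 1 % 4; omega
    exact Or.inr (conductorExponent_freyCurve_two_eq_four v hv h0 hp h4 h16)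
  · have hm : A ≡ -1 [ZMOD 4] := by show A % 4 = (-1) % 4; omega
    exact Or.inl (conductorExponent_freyCurve_two_eq_three v hv h0 hm h4 h16)

/-- **The complete table for `ord₂ (B) ≤ 3`: `f₂ ∈ {3, 4, 5}`** for the Frey curve
`y² = x (x − A) (x + B)` with `A` odd, `2 ∣ B`, `16 ∤ B`, `AB(A+B) ≠ 0`, at `2` — `2 ∥ B`:
`III`, `f₂ = 5` (`conductorExponent_freyCurve_two_of_two_dvd`, either sign); `4 ∥ B`: `I₁*` /
`I₀*`, `f₂ = 3 / 4`; `8 ∥ B`: `III*` / `I₂*`, `f₂ = 3 / 4` (good / bad sign).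
[cite: DiamondKramer1995, Lemma 1 and Lemma 2, p. 300] [cite: SilvermanATAEC1994, IV.9.4, IV.11.1] -/
theorem conductorExponent_freyCurve_two_mem_of_not_sixteen_dvd (hv : natGenerator v = 2)
    (h0 : A * B * (A + B) ≠ 0) (hA : ¬ (2 : ℤ) ∣ A) (h2 : (2 : ℤ) ∣ B) (h16 : ¬ (16 : ℤ) ∣ B) :
    (freyCurve A B).conductorExponent v = 3 ∨ (freyCurve A B).conductorExponent v = 4 ∨
      (freyCurve A B).conductorExponent v = 5 := by
  by_cases h4 : (4 : ℤ) ∣ B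
  · rcases conductorExponent_freyCurve_two_eq_three_or_four v hv h0 hA h4 h16 with h | h
    · exact Or.inl h
    · exact Or.inr (Or.inl h)
  · obtain ⟨b, hb⟩ := h2
    have hbodd : ¬ (2 : ℤ) ∣ b := fun ⟨e, he⟩ ↦ h4 ⟨e, by rw [hb, he]; ring⟩
    exact Or.inr (Or.inr (conductorExponent_freyCurve_two_of_two_dvd v hv h0 hA hb hbodd))

/-- **`f₂ ≠ 2`**: no presentation `y² = x (x − A) (x + B)` with `A` odd, `2 ∣ B`, `16 ∤ B`
(`AB(A+B) ≠ 0`) is tame at `2` — the table value is `3`, `4` or `5`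
(`conductorExponent_freyCurve_two_mem_of_not_sixteen_dvd`).  (Motivation: cell bsd-f2-manin,
E-imc-75-loc — a curve with conductor exponent `2` at `2` never has full `2`-torsion in this
shape.) [cite: DiamondKramer1995, Lemma 2, p. 300] [cite: SilvermanATAEC1994, IV.9.4, IV.11.1] -/
theorem conductorExponent_freyCurve_two_ne_two_of_not_sixteen_dvd (hv : natGenerator v = 2)
    (h0 : A * B * (A + B) ≠ 0) (hA : ¬ (2 : ℤ) ∣ A) (h2 : (2 : ℤ) ∣ B) (h16 : ¬ (16 : ℤ) ∣ B) :
    (freyCurve A B).conductorExponent v ≠ 2 := by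
  rcases conductorExponent_freyCurve_two_mem_of_not_sixteen_dvd v hv h0 hA h2 h16 with h | h | h <;>
    omega

end Local

/-! ### Appendix (same seat, second pass): the whole bad-sign family `2ᵏ ∥ B`, `k ≥ 3`: type `I*_{2k−4}`,
`ord₂ Δ_min = 2k + 4`, `f₂ = 4` — and `f₂ = 4` for `A ≡ 1 (mod 4)`, `4 ∣ B` with NO upper bound on `ord₂ B` -/

section Family

variable {A B : ℤ} (v : HeightOneSpectrum ℤ)

/-- **The Frey curve `y² = x (x − A) (x + B)` with `A ≡ 1 (mod 4)`, `2ᵏ ∥ B`, `k ≥ 3`, at `2`: Kodaira type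
`I*_{2k−4}`, `ord₂ (Δ_min) = 2k + 4`, conductor exponent `f₂ = (2k + 4) + 1 − (2k + 1) = 4`** — the bad-sign
family recorded (from PARI, uncomputed) in `FreyCurveConductorTwoTwistDichotomyProofs` as «`I*_{2k−4}`,
`t = 4`»; the case `k = 3` is `kodairaSymbolAt_freyCurve_two_of_eight_dvd_of_four_dvd_sub_one`.  For `k ≥ 4`
the integral equation has `ord₂ Δ = 2k + 4 ≥ 12`, so minimality is NOT read off the discriminant: it follows
from Tate's algorithm itself exiting at Step 7 (Silverman *ATAEC* IV.9.4 Step 11 read contrapositively: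
`WeierstrassCurve.isMinimal_baseChange_of_kodairaSymbolOfMinimal_ne_I_zero`, `TateAlgorithmExitMinimalityProofs`) —
in the good sign `A ≡ −1 (mod 4)` the same equations are NOT minimal for `k ≥ 4` (Diamond–Kramer Lemma 2:
`I₀`, `I_{2k−8}`).  Evaluation: the step-6 model `W₆ = (2, B − A − 1, 0, −AB, 0)` (`y ↦ y + x`,
Diamond–Kramer's (3)) has `π ∥ a₂`, `π^k ∥ a₄`, `a₃ = a₆ = 0`; its cubic is `T² (T + p̄)` and `W₆` is
normalised for every round of the `Iₙ*` sub-procedure; rounds `0, …, k − 4` see only vanishing coefficients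
(`istarIndexAux_add_of_dvd`), and in round `m = k − 3` the first quadratic is `Y²` while the second is
`p̄ X² + (a₄/π^k)‾ X`, separable (`istarIndexAux_succ_of_testB`): `n = 2(k − 3) + 2 = 2k − 4`.
[cite: DiamondKramer1995, Lemma 1 and Lemma 2, p. 300] [cite: SilvermanATAEC1994, IV.9.4 Steps 1–7, 11 and Table 4.1] -/
theorem kodairaSymbolAt_freyCurve_two_of_pow_dvd_of_four_dvd_sub_one (hv : natGenerator v = 2)
    (h0 : A * B * (A + B) ≠ 0) (hA : 4 ∣ A - 1) {k : ℕ} (hk : 3 ≤ k) {b : ℤ} (hB : B = 2 ^ k * b)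
    (hb : ¬ (2 : ℤ) ∣ b) :
    (freyCurve A B).kodairaSymbolAt v = .Istar (2 * k - 4) ∧
      (freyCurve A B).ordMinimalDiscriminant v = 2 * k + 4 ∧ (freyCurve A B).conductorExponent v = 4 := by
  obtain ⟨M, rfl⟩ : ∃ M, k = M + 3 := ⟨k - 3, by omega⟩
  haveI := isElliptic_freyCurve h0
  haveI hI := isIntegral_baseChange_freyCurve (A := A) (B := B) v
  have hA2 : ¬ (2 : ℤ) ∣ A := not_two_dvd_of_four_dvd_sub_one hA
  obtain ⟨k, hk'⟩ := hA
  have hAk : A = 4 * k + 1 := by linear_combination hk'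
  have hAB : ¬ (2 : ℤ) ∣ A + B := by
    rw [hB]; intro h; apply hA2
    have : A = (A + 2 ^ (M + 3) * b) - 2 * (2 ^ (M + 2) * b) := by ring
    rw [this]; exact dvd_sub h (dvd_mul_right 2 _)
  have hAb : ¬ (2 : ℤ) ∣ A * b := by
    intro h
    rcases Int.prime_two.dvd_or_dvd h with h | h
    · exact hA2 h
    · exact hb h
  have hodd₂ : ¬ (2 : ℤ) ∣ 2 ^ (M + 2) * b - 2 * k - 1 := by
    intro h
    have : (2 : ℤ) ∣ 2 * (2 ^ (M + 1) * b - k) - (2 ^ (M + 2) * b - 2 * k - 1) :=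
      dvd_sub (dvd_mul_right 2 _) h
    have h1 : 2 * (2 ^ (M + 1) * b - k) - (2 ^ (M + 2) * b - 2 * k - 1) = (1 : ℤ) := by ring
    rw [h1] at this
    exact absurd this (by norm_num)
  have h2 := residue_two_eq_zero_int v hv
  set φ := algebraMap ℤ (v.adicCompletionIntegers ℚ) with hφ
  set W₀ := (freyIntModel A B).map φ with hW₀
  set W₆ := (⟨2, B - A - 1, 0, -(A * B), 0⟩ : WeierstrassCurve ℤ).map φ with hW₆def
  set C₆ : VariableChange (v.adicCompletionIntegers ℚ) := (⟨1, 0, 1, 0⟩ : VariableChange ℤ).map φ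
    with hC₆
  have hW₆ : W₆ = C₆ • W₀ := by
    rw [hW₀, hC₆, map_variableChange, freyModel₆_eq]
  -- `ord₂ Δ(W₀) = 2k + 4`
  have hordΔ : (addVal (v.adicCompletionIntegers ℚ) W₀.Δ).toNat = 2 * (M + 3) + 4 :=
    addVal_Δ_freyIntModel_map_toNat v hv hB hb hA2 hAB
  -- divisibilities of the step-6 model `W₆ = (2, B − A − 1, 0, −AB, 0)`
  have q1 : uniformizer (v.adicCompletionIntegers ℚ) ∣ W₆.a₁ := by
    simp only [hW₆def, map_a₁, hφ, eq_intCast]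
    simpa using uniformizer_pow_dvd_intCast v hv (k := 1) (n := 2) (by norm_num)
  have q2 : uniformizer (v.adicCompletionIntegers ℚ) ∣ W₆.a₂ := by
    simp only [hW₆def, map_a₂, hφ, eq_intCast]
    simpa using uniformizer_pow_dvd_intCast v hv (k := 1) (n := B - A - 1)
      ⟨2 ^ (M + 2) * b - 2 * k - 1, by rw [hAk, hB]; ring⟩
  have q2n : ¬ uniformizer (v.adicCompletionIntegers ℚ) ^ 2 ∣ W₆.a₂ := by
    simp only [hW₆def, map_a₂, hφ, eq_intCast]
    exact not_uniformizer_pow_succ_dvd_intCast v hv (k := 1) (m := 2 ^ (M + 2) * b - 2 * k - 1)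
      (by rw [hAk, hB]; ring) hodd₂
  have q3 : ∀ j : ℕ, uniformizer (v.adicCompletionIntegers ℚ) ^ j ∣ W₆.a₃ := fun j ↦ by
    simp only [hW₆def, map_a₃, hφ, eq_intCast, Int.cast_zero]; exact dvd_zero _
  have q4 : uniformizer (v.adicCompletionIntegers ℚ) ^ (M + 3) ∣ W₆.a₄ := by
    simp only [hW₆def, map_a₄, hφ, eq_intCast]
    exact uniformizer_pow_dvd_intCast v hv (k := M + 3) ⟨-(A * b), by rw [hB]; ring⟩
  have q4n : ¬ uniformizer (v.adicCompletionIntegers ℚ) ^ (M + 3 + 1) ∣ W₆.a₄ := by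
    simp only [hW₆def, map_a₄, hφ, eq_intCast]
    refine not_uniformizer_pow_succ_dvd_intCast v hv (k := M + 3) (m := -(A * b))
      (by rw [hB]; ring) ?_
    rwa [dvd_neg]
  have q6 : ∀ j : ℕ, uniformizer (v.adicCompletionIntegers ℚ) ^ j ∣ W₆.a₆ := fun j ↦ by
    simp only [hW₆def, map_a₆, hφ, eq_intCast, Int.cast_zero]; exact dvd_zero _
  have q2' : uniformizer (v.adicCompletionIntegers ℚ) ^ 1 ∣ W₆.a₂ := by simpa using q2
  have hp : redCoeff W₆.a₂ 1 ≠ 0 := by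
    rw [Ne, redCoeff_eq_zero_iff q2']
    exact q2n
  have hq0 : redCoeff W₆.a₄ 2 = 0 :=
    redCoeff_eq_zero_of_dvd ((pow_dvd_pow _ (by omega)).trans q4)
  have hu : redCoeff W₆.a₄ (M + 3) ≠ 0 := by
    rw [Ne, redCoeff_eq_zero_iff q4]
    exact q4n
  have hr : ∀ j : ℕ, redCoeff W₆.a₆ j = 0 := fun j ↦ redCoeff_eq_zero_of_dvd (q6 _)
  have hr3 : ∀ j : ℕ, redCoeff W₆.a₃ j = 0 := fun j ↦ redCoeff_eq_zero_of_dvd (q3 _)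
  -- the evaluation: type `Iₙ*` with `n` computed by the sub-procedure on `W₆` itself
  have hK0 : W₀.kodairaSymbolOfMinimal =
      .Istar (istarIndexAux (addVal (v.adicCompletionIntegers ℚ) W₀.Δ).toNat 0 W₆) := by
    refine kodairaSymbolOfMinimal_eq_Istar_of_models (W₂ := W₀) (C₂ := 1) ?_ (one_smul _ _).symm
      ?_ ?_ ?_ ?_ ?_ ?_ ?_ hW₆ q1 q2 (q3 2) ((pow_dvd_pow _ (by omega)).trans q4) (q6 3) ?_
      (one_smul _ _).symm q1 q2 q2n (q3 2) ((pow_dvd_pow _ (by omega)).trans q4) (q6 4)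
    · rw [hW₀, map_Δ, freyIntModel_Δ, hφ, eq_intCast]
      simpa only [pow_one] using uniformizer_pow_dvd_intCast v hv (k := 1)
        (n := 16 * (A * B * (A + B)) ^ 2) ⟨8 * (A * B * (A + B)) ^ 2, by ring⟩
    · simp only [hW₀, freyIntModel, map_a₃, hφ, eq_intCast, Int.cast_zero]; exact dvd_zero _
    · simp only [hW₀, freyIntModel, map_a₄, hφ, eq_intCast]
      simpa using uniformizer_pow_dvd_intCast v hv (k := 1) (n := -(A * B))
        ⟨-(2 ^ (M + 2) * A * b), by rw [hB]; ring⟩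
    · simp only [hW₀, freyIntModel, map_a₆, hφ, eq_intCast, Int.cast_zero]; exact dvd_zero _
    · rw [hW₀, map_b₂, (freyIntModel_b A B).1, hφ, eq_intCast]
      simpa using uniformizer_pow_dvd_intCast v hv (k := 1) (n := 4 * (B - A)) ⟨2 * (B - A), by ring⟩
    · simp only [hW₀, freyIntModel, map_a₆, hφ, eq_intCast, Int.cast_zero]; exact dvd_zero _
    · rw [hW₀, map_b₈, (freyIntModel_b A B).2.2, hφ, eq_intCast]
      exact uniformizer_pow_dvd_intCast v hv (k := 3)
        ⟨-(2 ^ (2 * M + 3) * A ^ 2 * b ^ 2), by rw [hB]; ring⟩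
    · rw [hW₀, map_b₆, (freyIntModel_b A B).2.1, hφ, eq_intCast, Int.cast_zero]; exact dvd_zero _
    · -- the step-6 cubic `T² (T + p̄)`, `p̄ ≠ 0`: exactly two distinct roots
      set p := redCoeff W₆.a₂ 1 with hpdef
      show distinctRootCount (X ^ 3 + C (redCoeff W₆.a₂ 1) * X ^ 2 + C (redCoeff W₆.a₄ 2) * X +
        C (redCoeff W₆.a₆ 3)) = 2
      rw [hq0, hr 3, ← hpdef]
      refine (distinctRootCount_cubic_eq_two_iff p 0 0 (by ring)).mpr ?_
      rw [mul_zero, sub_zero]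
      exact pow_ne_zero 2 hp
  -- rounds `0, …, M − 1` pass on `W₆` itself; round `M` exits at the second quadratic `p̄ X² + ū X`
  have hA7 : distinctRootCount (X ^ 2 + C (redCoeff W₆.a₃ (M + 2)) * X -
      C (redCoeff W₆.a₆ (2 * M + 4))) ≠ 2 := by
    intro h
    exact ((testA_iff_of_two_eq_zero h2 _ _).mp h) (hr3 _)
  have hB7 : distinctRootCount (C (redCoeff W₆.a₂ 1) * X ^ 2 + C (redCoeff W₆.a₄ (M + 3)) * X
      + C (redCoeff W₆.a₆ (2 * M + 5))) = 2 :=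
    (testB_iff_of_two_eq_zero h2 hp _ _).mpr hu
  have hn : istarIndexAux (addVal (v.adicCompletionIntegers ℚ) W₀.Δ).toNat 0 W₆ = 2 * M + 2 := by
    rw [hordΔ, show 2 * (M + 3) + 4 = (M + 9 + 1) + M by ring,
      istarIndexAux_add_of_dvd q1 q2 q2n (q3 _) q4 (q6 _) M 0 (M + 9 + 1) (by simp)]
    exact istarIndexAux_succ_of_testB (fuel := M + 9) (m := M) (W := W₆) (W₁ := W₆) (C₁ := 1)
      q1 q2 q2n (q3 _) q4 (q6 _) hA7 (one_smul _ _).symm q1 q2 q2n (q3 _) q4 (q6 _) hB7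
  rw [hn] at hK0
  -- minimality from the exit of the algorithm (Step 11 never reached), then read-back over `ℚ`
  haveI hmin : ((freyCurve A B).baseChange (v.adicCompletion ℚ)).IsMinimal
      (v.adicCompletionIntegers ℚ) := by
    rw [baseChange_freyCurve_eq_baseChange_map]
    exact WeierstrassCurve.isMinimal_baseChange_of_kodairaSymbolOfMinimal_ne_I_zero W₀
      (by rw [hK0]; exact fun h ↦ by cases h)
  have hΔ : ((freyCurve A B).baseChange (v.adicCompletion ℚ)).Δ ≠ 0 := by
    haveI : ((freyCurve A B).baseChange (v.adicCompletion ℚ)).IsElliptic := by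
      rw [WeierstrassCurve.baseChange]; infer_instance
    exact ((freyCurve A B).baseChange (v.adicCompletion ℚ)).isUnit_Δ.ne_zero
  have hrel : (freyCurve A B).baseChange (v.adicCompletion ℚ) =
      (1 : VariableChange (v.adicCompletion ℚ)) • (freyCurve A B).baseChange (v.adicCompletion ℚ) :=
    (one_smul _ _).symm
  have hIM := integralModel_baseChange_freyCurve (A := A) (B := B) v
  have hK : (freyCurve A B).kodairaSymbolAt v = .Istar (2 * M + 2) := by
    rw [kodairaSymbolAt_eq_kodairaSymbolOfMinimal_of_isMinimal v (freyCurve A B) _ 1 hrel hΔ, hIM,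
      hK0]
  have hord : (freyCurve A B).ordMinimalDiscriminant v = 2 * (M + 3) + 4 := by
    rw [ordMinimalDiscriminant_eq_of_isMinimal v (freyCurve A B) _ 1 hrel hΔ, hIM, hordΔ]
  refine ⟨by rw [show 2 * (M + 3) - 4 = 2 * M + 2 by omega]; exact hK, hord, ?_⟩
  show (freyCurve A B).ordMinimalDiscriminant v + 1 - (freyCurve A B).numComponentsAt v = 4
  rw [numComponentsAt, hK, hord, KodairaSymbol.numComponents_Istar]
  omega

/-- **`f₂ = 4` for `A ≡ 1 (mod 4)` and `4 ∣ B`, whatever `ord₂ B`** (`AB(A+B) ≠ 0`): the bad-sign Frey curve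
`y² = x (x − A) (x + B)` at `2` is of type `I₀*` (`4 ∥ B`) or `I*_{2k−4}` (`2ᵏ ∥ B`, `k ≥ 3`), always with
conductor exponent `4` — the quadratic twist by `ℚ(i)` (Diamond–Kramer Lemma 1) of the good-sign rows `t = 3, 3,
0, 1` (Lemma 2). [cite: DiamondKramer1995, Lemma 1 and Lemma 2, p. 300]
[cite: SilvermanATAEC1994, IV.9.4 and Table 4.1, IV.11.1] -/
theorem conductorExponent_freyCurve_two_eq_four_of_four_dvd (hv : natGenerator v = 2)
    (h0 : A * B * (A + B) ≠ 0) (hA : A ≡ 1 [ZMOD 4]) (h4 : (4 : ℤ) ∣ B) :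
    (freyCurve A B).conductorExponent v = 4 := by
  have hA' : 4 ∣ A - 1 := (Int.ModEq.dvd hA.symm)
  have hB0 : B ≠ 0 := by
    rintro rfl
    exact h0 (by ring)
  -- write `B = 2ᵏ b` with `b` odd, `k = multiplicity`
  obtain ⟨k, b, hb, hB⟩ : ∃ (k : ℕ) (b : ℤ), ¬ (2 : ℤ) ∣ b ∧ B = 2 ^ k * b :=
    WfDvdMonoid.max_power_factor hB0 Int.prime_two.irreducible
  have hk2 : 2 ≤ k := by
    by_contra hlt
    push Not at hlt
    interval_cases k
    · rw [hB, pow_zero, one_mul] at h4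
      exact hb ((show (2 : ℤ) ∣ 4 by norm_num).trans h4)
    · rw [hB, pow_one] at h4
      have h4' : (2 : ℤ) * 2 ∣ 2 * b := by simpa [show (4 : ℤ) = 2 * 2 by norm_num] using h4
      exact hb ((mul_dvd_mul_iff_left two_ne_zero).mp h4')
  rcases Nat.lt_or_ge k 3 with hlt | hge
  · have hk : k = 2 := by omega
    subst hk
    exact (kodairaSymbolAt_freyCurve_two_of_four_dvd_of_four_dvd_sub_one v hv h0 hA' (b := b)
      (by rw [hB]; ring) hb).2.2
  · exact (kodairaSymbolAt_freyCurve_two_of_pow_dvd_of_four_dvd_sub_one v hv h0 hA' hge hB hb).2.2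

end Family

end Literature.NumberTheory.DiophantineGeometry
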